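import Mathlib
import Summits.Ventures.PercRepro2.Defs
import Summits.Ventures.PercRepro2.Graph
import Summits.Ventures.PercRepro2.Harris
import Summits.Ventures.PercRepro2.RowC1Cross
import Summits.Ventures.PercRepro2.RowC1CrossRoot
import Summits.Ventures.PercRepro2.RowC1CrossRootB

/-!
# The cross-term identity of row 2′C1 and the sign-agreement criterion
(blind cell PercRepro2, p2 g34; proofs/P2-G34-ROOT.md §1)

For the row `c1Slack p = A·B − C·D` (`A = P(Q)`, `B = P(Q, o ∈ U, b ∈ U)`, `C = P(Q, b ∈ H)`,
`D = P(Q, o ∈ U)`) and an edge `e`, with superscripts `0 / 1` for `e` pinned closed / open, the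
single-edge cross term `c1Cross p e = A⁰B¹ + A¹B⁰ − C⁰D¹ − C¹D⁰` (RowC1Cross.lean) satisfies

  `A⁰ A¹ · c1Cross p e = (A⁰)² · c1Slack p[e↦1] + (A¹)² · c1Slack p[e↦0]
                          + (A⁰C¹ − A¹C⁰) · (A⁰D¹ − A¹D⁰)`            (`c1Cross_mul_eq`),

a ring identity.  The last factors are (up to the positive factor `A⁰A¹`) the SHIFTS of the two
`Q`-conditional probabilities `P(b ∈ H | Q)` and `P(o ∈ U | Q)` when `e` is opened.  Hence
(`c1Cross_nonneg_of_shift_prod`): the cross term is nonnegative whenever the rows of the two pinned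
vectors are (the induction hypothesis of `c1Slack_nonneg_of_cross`) and the two shifts agree in
sign; when `A⁰A¹ = 0` the cross term vanishes.  At an `a₂`-edge the `bH`-shift is `≥ 0`
(`bHQ_pin_open_mul_ge`, the cell's `CCT.shift_root_edge`), at an `a₁`-edge it is `≤ 0`
(`bHQ_pin_open_mul_le`), so at a root edge the criterion is the sign of the `oU`-shift alone
(`c1Cross_nonneg_of_a₂_edge`, `c1Cross_nonneg_of_a₁_edge`).  Std axioms.
-/

namespace Summit.Ventures.PercRepro2

namespace RowC1

section Identity

variable {V : Type*} {E : Type*} [Fintype E] [DecidableEq E] [Fintype V] [DecidableEq V]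
  {R : Type*} [Field R] [LinearOrder R] [IsStrictOrderedRing R]

omit [Fintype V] [DecidableEq V] [LinearOrder R] [IsStrictOrderedRing R] in
/-- **The cross-term identity**: `A⁰ A¹ · c1Cross p e = (A⁰)² · c1Slack p[e↦1] +
(A¹)² · c1Slack p[e↦0] + (A⁰C¹ − A¹C⁰)(A⁰D¹ − A¹D⁰)` (pure algebra on the definitions). -/
theorem c1Cross_mul_eq (p : E → R) (ends : E → Sym2 V) (a₁ a₂ o b : V) (e : E) :
    prob (Function.update p e (0 : R)) (connEvent ends a₁ a₂)ᶜ *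
        prob (Function.update p e (1 : R)) (connEvent ends a₁ a₂)ᶜ *
        c1Cross p ends a₁ a₂ o b e =
      (prob (Function.update p e (0 : R)) (connEvent ends a₁ a₂)ᶜ) ^ 2 *
          c1Slack (Function.update p e (1 : R)) ends a₁ a₂ o b +
        (prob (Function.update p e (1 : R)) (connEvent ends a₁ a₂)ᶜ) ^ 2 *
          c1Slack (Function.update p e (0 : R)) ends a₁ a₂ o b +
        (prob (Function.update p e (0 : R)) (connEvent ends a₁ a₂)ᶜ *
            prob (Function.update p e (1 : R)) (connEvent ends a₂ b ∩ (connEvent ends a₁ a₂)ᶜ) -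
          prob (Function.update p e (1 : R)) (connEvent ends a₁ a₂)ᶜ *
            prob (Function.update p e (0 : R)) (connEvent ends a₂ b ∩ (connEvent ends a₁ a₂)ᶜ)) *
        (prob (Function.update p e (0 : R)) (connEvent ends a₁ a₂)ᶜ *
            prob (Function.update p e (1 : R))
              ((connEvent ends a₁ o ∪ connEvent ends a₂ o) ∩ (connEvent ends a₁ a₂)ᶜ) -
          prob (Function.update p e (1 : R)) (connEvent ends a₁ a₂)ᶜ *
            prob (Function.update p e (0 : R))
              ((connEvent ends a₁ o ∪ connEvent ends a₂ o) ∩ (connEvent ends a₁ a₂)ᶜ)) := by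
  unfold c1Cross c1Slack
  ring

omit [Fintype V] [DecidableEq V] in
/-- If `Q` has probability `0` with `e` pinned to `c`, every `Q`-mass of `p[e↦c]` vanishes. -/
lemma prob_Q_sub_eq_zero (p : E → R) (hp : IsProbVec p) (ends : E → Sym2 V) (a₁ a₂ : V)
    (e : E) (c : R) (h0 : 0 ≤ c) (h1 : c ≤ 1)
    (hA : prob (Function.update p e c) (connEvent ends a₁ a₂)ᶜ = 0)
    (X : Set (Config E)) :
    prob (Function.update p e c) (X ∩ (connEvent ends a₁ a₂)ᶜ) = 0 := by
  have hp' := hp.update e h0 h1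
  refine le_antisymm ?_ (prob_nonneg hp' _)
  calc prob (Function.update p e c) (X ∩ (connEvent ends a₁ a₂)ᶜ)
      ≤ prob (Function.update p e c) (connEvent ends a₁ a₂)ᶜ :=
        prob_mono hp' Set.inter_subset_right
    _ = 0 := hA

omit [Fintype V] [DecidableEq V] in
/-- When `Q` is impossible with `e` closed or with `e` open, the cross term vanishes. -/
lemma c1Cross_eq_zero_of_mul_eq_zero (p : E → R) (hp : IsProbVec p) (ends : E → Sym2 V)
    (a₁ a₂ o b : V) (e : E)
    (h : prob (Function.update p e (0 : R)) (connEvent ends a₁ a₂)ᶜ *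
        prob (Function.update p e (1 : R)) (connEvent ends a₁ a₂)ᶜ = 0) :
    c1Cross p ends a₁ a₂ o b e = 0 := by
  rcases mul_eq_zero.1 h with hA | hA
  · have hB := prob_Q_sub_eq_zero p hp ends a₁ a₂ e 0 le_rfl zero_le_one hA
      ((connEvent ends a₁ o ∪ connEvent ends a₂ o) ∩ (connEvent ends a₁ b ∪ connEvent ends a₂ b))
    have hC := prob_Q_sub_eq_zero p hp ends a₁ a₂ e 0 le_rfl zero_le_one hA (connEvent ends a₂ b)
    have hD := prob_Q_sub_eq_zero p hp ends a₁ a₂ e 0 le_rfl zero_le_one hA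
      (connEvent ends a₁ o ∪ connEvent ends a₂ o)
    unfold c1Cross
    rw [hA, hB, hC, hD]
    ring
  · have hB := prob_Q_sub_eq_zero p hp ends a₁ a₂ e 1 zero_le_one le_rfl hA
      ((connEvent ends a₁ o ∪ connEvent ends a₂ o) ∩ (connEvent ends a₁ b ∪ connEvent ends a₂ b))
    have hC := prob_Q_sub_eq_zero p hp ends a₁ a₂ e 1 zero_le_one le_rfl hA (connEvent ends a₂ b)
    have hD := prob_Q_sub_eq_zero p hp ends a₁ a₂ e 1 zero_le_one le_rfl hA
      (connEvent ends a₁ o ∪ connEvent ends a₂ o)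
    unfold c1Cross
    rw [hA, hB, hC, hD]
    ring

omit [Fintype V] [DecidableEq V] in
/-- **The sign-agreement criterion**: the cross term at `e` is nonnegative as soon as the rows of
the two pinned vectors are nonnegative and the two `Q`-conditional shifts
`A⁰C¹ − A¹C⁰` (of `P(b ∈ H | Q)`) and `A⁰D¹ − A¹D⁰` (of `P(o ∈ U | Q)`) have a nonnegative
product. -/
theorem c1Cross_nonneg_of_shift_prod (p : E → R) (hp : IsProbVec p) (ends : E → Sym2 V)
    (a₁ a₂ o b : V) (e : E)
    (h0 : 0 ≤ c1Slack (Function.update p e (0 : R)) ends a₁ a₂ o b)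
    (h1 : 0 ≤ c1Slack (Function.update p e (1 : R)) ends a₁ a₂ o b)
    (hS : 0 ≤ (prob (Function.update p e (0 : R)) (connEvent ends a₁ a₂)ᶜ *
            prob (Function.update p e (1 : R)) (connEvent ends a₂ b ∩ (connEvent ends a₁ a₂)ᶜ) -
          prob (Function.update p e (1 : R)) (connEvent ends a₁ a₂)ᶜ *
            prob (Function.update p e (0 : R)) (connEvent ends a₂ b ∩ (connEvent ends a₁ a₂)ᶜ)) *
        (prob (Function.update p e (0 : R)) (connEvent ends a₁ a₂)ᶜ *
            prob (Function.update p e (1 : R))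
              ((connEvent ends a₁ o ∪ connEvent ends a₂ o) ∩ (connEvent ends a₁ a₂)ᶜ) -
          prob (Function.update p e (1 : R)) (connEvent ends a₁ a₂)ᶜ *
            prob (Function.update p e (0 : R))
              ((connEvent ends a₁ o ∪ connEvent ends a₂ o) ∩ (connEvent ends a₁ a₂)ᶜ))) :
    0 ≤ c1Cross p ends a₁ a₂ o b e := by
  set A0 := prob (Function.update p e (0 : R)) (connEvent ends a₁ a₂)ᶜ with hA0
  set A1 := prob (Function.update p e (1 : R)) (connEvent ends a₁ a₂)ᶜ with hA1
  have hA0n : 0 ≤ A0 := prob_nonneg (hp.update e le_rfl zero_le_one) _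
  have hA1n : 0 ≤ A1 := prob_nonneg (hp.update e zero_le_one le_rfl) _
  rcases (mul_nonneg hA0n hA1n).lt_or_eq with hpos | hzero
  · have hid := c1Cross_mul_eq p ends a₁ a₂ o b e
    rw [← hA0, ← hA1] at hid
    have hsum : 0 ≤ A0 * A1 * c1Cross p ends a₁ a₂ o b e := by
      rw [hid]
      have t1 : 0 ≤ A0 ^ 2 * c1Slack (Function.update p e (1 : R)) ends a₁ a₂ o b :=
        mul_nonneg (sq_nonneg _) h1
      have t2 : 0 ≤ A1 ^ 2 * c1Slack (Function.update p e (0 : R)) ends a₁ a₂ o b :=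
        mul_nonneg (sq_nonneg _) h0
      linarith
    exact (mul_nonneg_iff_of_pos_left hpos).1 hsum
  · rw [c1Cross_eq_zero_of_mul_eq_zero p hp ends a₁ a₂ o b e hzero.symm]

/-- **At an `a₂`-edge** the `bH`-shift is `≥ 0` (`bHQ_pin_open_mul_ge`), so the cross term is
nonnegative modulo the rows of the pinned vectors as soon as the `oU`-shift is `≥ 0`:
`P⁰(Q) P¹(Q, o ∈ U) ≥ P¹(Q) P⁰(Q, o ∈ U)`. -/
theorem c1Cross_nonneg_of_a₂_edge (p : E → R) (hp : IsProbVec p) (ends : E → Sym2 V) {e : E}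
    {a₂ v : V} (hends : ends e = s(a₂, v)) (a₁ o b : V)
    (h0 : 0 ≤ c1Slack (Function.update p e (0 : R)) ends a₁ a₂ o b)
    (h1 : 0 ≤ c1Slack (Function.update p e (1 : R)) ends a₁ a₂ o b)
    (hD : prob (Function.update p e (1 : R)) (connEvent ends a₁ a₂)ᶜ *
          prob (Function.update p e (0 : R))
            ((connEvent ends a₁ o ∪ connEvent ends a₂ o) ∩ (connEvent ends a₁ a₂)ᶜ) ≤
        prob (Function.update p e (0 : R)) (connEvent ends a₁ a₂)ᶜ *
          prob (Function.update p e (1 : R))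
            ((connEvent ends a₁ o ∪ connEvent ends a₂ o) ∩ (connEvent ends a₁ a₂)ᶜ)) :
    0 ≤ c1Cross p ends a₁ a₂ o b e := by
  apply c1Cross_nonneg_of_shift_prod p hp ends a₁ a₂ o b e h0 h1
  have hC := bHQ_pin_open_mul_ge p hp ends hends a₁ b
  apply mul_nonneg
  · linarith
  · linarith

/-- **At an `a₁`-edge** the `bH`-shift is `≤ 0` (`bHQ_pin_open_mul_le`), so the cross term is
nonnegative modulo the rows of the pinned vectors as soon as the `oU`-shift is `≤ 0`:
`P⁰(Q) P¹(Q, o ∈ U) ≤ P¹(Q) P⁰(Q, o ∈ U)`. -/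
theorem c1Cross_nonneg_of_a₁_edge (p : E → R) (hp : IsProbVec p) (ends : E → Sym2 V) {e : E}
    {a₁ v : V} (hends : ends e = s(a₁, v)) (a₂ o b : V)
    (h0 : 0 ≤ c1Slack (Function.update p e (0 : R)) ends a₁ a₂ o b)
    (h1 : 0 ≤ c1Slack (Function.update p e (1 : R)) ends a₁ a₂ o b)
    (hD : prob (Function.update p e (0 : R)) (connEvent ends a₁ a₂)ᶜ *
          prob (Function.update p e (1 : R))
            ((connEvent ends a₁ o ∪ connEvent ends a₂ o) ∩ (connEvent ends a₁ a₂)ᶜ) ≤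
        prob (Function.update p e (1 : R)) (connEvent ends a₁ a₂)ᶜ *
          prob (Function.update p e (0 : R))
            ((connEvent ends a₁ o ∪ connEvent ends a₂ o) ∩ (connEvent ends a₁ a₂)ᶜ)) :
    0 ≤ c1Cross p ends a₁ a₂ o b e := by
  apply c1Cross_nonneg_of_shift_prod p hp ends a₁ a₂ o b e h0 h1
  have hC := bHQ_pin_open_mul_le p hp ends hends a₂ b
  apply mul_nonneg_of_nonpos_of_nonpos
  · linarith
  · linarith

end Identity

end RowC1

end Summit.Ventures.PercRepro2
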